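import Literature.RingTheory.MvPolynomial.MultigradedHilbertPolynomial
import Literature.RingTheory.MvPolynomial.ShiftCalculus
import Literature.RingTheory.MvPolynomial.TopFormBounds
import Literature.RingTheory.MvPolynomial.SaturationChain
import Mathlib.Algebra.Order.Sub.Prod
import Literature.RingTheory.MvPolynomial.EquidimensionalHilbert
import Mathlib.RingTheory.Nullstellensatz
import Mathlib.RingTheory.KrullDimension.Polynomial
import Mathlib.RingTheory.KrullDimension.Field
import HarnessLib

/-!
# The multigraded refined Bézout count: isolated components of `V(Q_1, …, Q_r)` in a product of
# projective spaces number at most the mixed Bézout number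

Topic: `Literature/RingTheory/MvPolynomial`. Let `S = K[X_0, …, X_{n-1}]` carry the block
multigrading of `blk : Fin n → ι` (blocks of sizes `n_l ≥ 1`, i.e. `S` is the multihomogeneous
coordinate ring of `ℙ = Π_l ℙ^{n_l - 1}`, of dimension `r = Σ_l (n_l - 1) = n - |ι|`), and let
`Q_1, …, Q_r` be non-zero multihomogeneous forms of multidegrees `δ_1, …, δ_r ∈ ℕ^ι`. Let `𝓟` be
a finite set of primes each MINIMAL over `𝔞 = (Q_1, …, Q_r)` and of dimension `dim S/𝔓 = |ι|`
(multi-cones over points of `ℙ`: the isolated points of `V(𝔞) ⊂ ℙ`), whose intersection has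
Hilbert function eventually equal to `|𝓟|` (distinct points impose independent conditions in
large multidegree). Then (`card_le_mixedBezout`)

  `|𝓟| ≤ [T^{(n_l - 1)_l}] Π_j (Σ_l δ_{j,l} T_l)`,

the mixed Bézout number, WHATEVER the positive-dimensional components of `V(𝔞)`. This is the
refined Bézout theorem in a product of projective spaces (Fulton, *Intersection Theory*,
Ex. 12.3.1 / Thm. 12.3 for globally generated bundles; van der Waerden 1928 for the transversal
multiprojective Bézout theorem), proved here from first principles by van der Waerden's
Hilbert-function method with two twists that avoid graded prime avoidance, associated primes and
Cohen–Macaulayness: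

* the cuts are the given `Q_j` in the given order; before cutting by `Q_{j+1}` the current ideal
  `K_j` is replaced by its saturation `K̃ = (K_j : Q_{j+1}^∞)` (`exists_saturation`), so that
  `Q_{j+1}` becomes a non-zero-divisor and the difference formula for Hilbert functions is EXACT
  (`finrank_wpiece_sup_span_add_eq`); the saturation stays inside every target `𝔓` because a
  minimal prime of `K_j` inside `𝔓` cannot contain `Q_{j+1}` — otherwise adding
  `Q_{j+2}, …, Q_r` one at a time would produce a prime over `𝔞` strictly inside `𝔓`
  (`not_mem_of_mem_minimalPrimes_of_lt`: dimension count with Krull's principal ideal theorem);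
* the loss in passing to `K̃` is controlled coefficientwise on TOP FORMS of Hilbert polynomials:
  `K_j = K̃ ∩ (K_j + (Q^N))` gives `P_{K̃} = P_{K_j} - P_{S/(K_j + Q^N)} + P_{S/(K̃ + Q^N)}`, the
  last term has lower degree (`Q^N` is a non-zero-divisor modulo `K̃`), and the top form of the
  Hilbert polynomial of ANY cyclic multigraded quotient has non-negative coefficients
  (`exists_hilbertMvPolynomial`, from the orthant decomposition of standard monomials); the top
  form then evolves by the directional derivative `L_δ = Σ_l δ_l ∂_l` at each cut
  (`homogeneousComponent_sub_shift`), which is monotone on coefficients, and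
  `(L_{δ_r} ∘ ⋯ ∘ L_{δ_1})(Π_l T_l^{n_l-1}/(n_l-1)!)` is the mixed Bézout number
  (`iterDirDeriv_monomial`).

## References

* W. Fulton, *Intersection Theory*, 2nd ed., Springer 1998, Example 12.3.1, Theorem 12.3.
  [Fulton1998]
* B. L. van der Waerden, *On Hilbert's function, series of composition of ideals and a
  generalization of the theorem of Bézout*, Proc. Royal Acad. Amsterdam 31 (1928), 749–770.

## Part II — isolated points (geometric form, `card_le_mixedBezout_of_isolated`)

The point-set companion: over an algebraically closed field, let `Q_1, …, Q_r` be as above and let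
`T` be a finite set of common zeros with a non-zero coordinate in every block, pairwise not
torus-translates of each other, each ISOLATED in the sense that some polynomial `F` with
`F(z) ≠ 0` has all common zeros `y` of the `Q_j` with `F(y) ≠ 0` among the torus-translates of
points of `T`. Then `|T|` is at most the mixed Bézout number (`card_le_mixedBezout_of_isolated`,
and `card_le_mixedBezout_of_isolated_fintype` for arbitrary finite index types). The bridge is
the **multi-cone prime** `𝔓_z = ker (X_i ↦ z_i T_{blk i})` of a point `z` (`S → K[T_l]`): its
kernel on multihomogeneous `g` is `g(z) = 0`, it is closed under multihomogeneous components,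
`S/𝔓_z ≅ K[T_ι]` has dimension `|ι|`, its zero set is the torus orbit of `z`, isolated zeros
give minimal primes (Nullstellensatz), and finitely many distinct orbits impose independent
conditions on forms of large multidegree (`hilbert_inf_multiCone_eq_card`).
-/

noncomputable section

open MvPolynomial Finset Module

namespace Literature.RingTheory.MvPolynomial

variable {ι : Type*} [Fintype ι] [DecidableEq ι]

/-! ## Polynomial book-keeping of one section-and-saturation step -/

omit [Fintype ι] [DecidableEq ι] in
/-- **The saturation step on top forms.** From the lattice identity `P̃ + P₂ = P + P₃`
(Hilbert polynomials of `K̃`, `K + (Q^N)`, `K`, `K̃ + (Q^N)`), degree bounds `≤ k` on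
`P, P̃, P₂` and `≤ k - 1` on `P₃`, non-negativity of the top form of `P₂` and the coefficientwise
bound `[P]_k ≤ G` by a form `G` of degree `k`, one gets `[P̃]_k ≤ G` coefficientwise. [folklore] -/
theorem coeff_homogeneousComponent_le_of_add_eq {P Ptil P₂ P₃ G : MvPolynomial ι ℚ} {k : ℕ}
    (hk : 1 ≤ k) (hid : Ptil + P₂ = P + P₃)
    (hP₂ : P₂.totalDegree ≤ k) (hP₃ : P₃.totalDegree ≤ k - 1) (hG : G.IsHomogeneous k)
    (hPG : ∀ α : ι →₀ ℕ, α.degree = k → coeff α P ≤ coeff α G)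
    (hpos : ∀ α : ι →₀ ℕ, P₂.totalDegree ≤ α.degree → 0 ≤ coeff α P₂) (β : ι →₀ ℕ) :
    coeff β (homogeneousComponent k Ptil) ≤ coeff β G := by
  rw [coeff_homogeneousComponent]
  by_cases hβ : β.degree = k
  · rw [if_pos hβ]
    have h := congr_arg (coeff β) hid
    rw [coeff_add, coeff_add] at h
    have hβsum : (∑ i ∈ β.support, β i) = k := hβ
    have h3 : coeff β P₃ = 0 := coeff_eq_zero_of_totalDegree_lt (by rw [hβsum]; omega)
    have h2 : 0 ≤ coeff β P₂ := hpos β (by omega)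
    have := hPG β hβ
    linarith
  · rw [if_neg hβ, hG.coeff_eq_zero hβ]

/-- **The section step on top forms.** If `deg P̃ ≤ k`, `k ≥ 1`, and `[P̃]_k ≤ G` coefficientwise,
then `P' = P̃ - P̃(T - δ)` has `deg P' ≤ k - 1` and its coefficients in degree `k - 1` are bounded
by those of `L_δ G`. [folklore] -/
theorem coeff_sub_shift_le {Ptil G : MvPolynomial ι ℚ} {k : ℕ} (hk : 1 ≤ k)
    (hPtil : Ptil.totalDegree ≤ k) (δ : ι → ℕ)
    (h : ∀ β, coeff β (homogeneousComponent k Ptil) ≤ coeff β G) :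
    (Ptil - aeval (fun l => X l - C (δ l : ℚ)) Ptil).totalDegree ≤ k - 1 ∧
      ∀ α : ι →₀ ℕ, α.degree = k - 1 →
        coeff α (Ptil - aeval (fun l => X l - C (δ l : ℚ)) Ptil) ≤
          coeff α (∑ l, (δ l : ℚ) • pderiv l G) := by
  refine ⟨totalDegree_sub_shift_le δ hPtil, fun α hα => ?_⟩
  have hc : coeff α (Ptil - aeval (fun l => X l - C (δ l : ℚ)) Ptil) =
      coeff α (homogeneousComponent (k - 1) (Ptil - aeval (fun l => X l - C (δ l : ℚ)) Ptil)) := by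
    rw [coeff_homogeneousComponent, if_pos hα]
  rw [hc, homogeneousComponent_sub_shift δ hPtil hk]
  exact coeff_dirDeriv_le δ h α

/-! ## The iterated operator `G_j = (L_{δ_j} ∘ ⋯ ∘ L_{δ_1}) F₀` -/

omit [DecidableEq ι] in
/-- One more cut: `G_{j+1} = L_{δ_{j+1}} G_j` for the fold over the first `j + 1` directions.
[folklore] -/
theorem foldl_take_succ {r : ℕ} (δ : Fin r → ι → ℕ) (F₀ : MvPolynomial ι ℚ) {j : ℕ}
    (hj : j < r) :
    ((List.ofFn δ).take (j + 1)).foldl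
        (fun (F : MvPolynomial ι ℚ) (d : ι → ℕ) => ∑ l, (d l : ℚ) • pderiv l F) F₀ =
      ∑ l, (δ ⟨j, hj⟩ l : ℚ) • pderiv l
        (((List.ofFn δ).take j).foldl
          (fun (F : MvPolynomial ι ℚ) (d : ι → ℕ) => ∑ l, (d l : ℚ) • pderiv l F) F₀) := by
  have hlen : j < (List.ofFn δ).length := by rw [List.length_ofFn]; exact hj
  rw [List.take_succ_eq_append_getElem hlen, List.foldl_append, List.foldl_cons, List.foldl_nil,
    List.getElem_ofFn]

omit [DecidableEq ι] in
/-- The folds are homogeneous: `G_j` is a form of degree `deg F₀ - j`. [folklore] -/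
theorem isHomogeneous_foldl_take {r : ℕ} (δ : Fin r → ι → ℕ) {F₀ : MvPolynomial ι ℚ} {d : ℕ}
    (hF₀ : F₀.IsHomogeneous d) :
    ∀ j : ℕ, j ≤ r → (((List.ofFn δ).take j).foldl
      (fun (F : MvPolynomial ι ℚ) (d : ι → ℕ) => ∑ l, (d l : ℚ) • pderiv l F) F₀).IsHomogeneous
        (d - j) := by
  intro j
  induction j with
  | zero => intro _; simpa using hF₀
  | succ j ih =>
    intro hj
    rw [foldl_take_succ δ F₀ (Nat.lt_of_succ_le hj), show d - (j + 1) = (d - j) - 1 by omega]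
    exact isHomogeneous_dirDeriv _ (ih (Nat.le_of_succ_le hj))

omit [DecidableEq ι] in
/-- The fold is linear in the initial form: `fold (c • F) = c • fold F`. [folklore] -/
theorem foldl_smul (L : List (ι → ℕ)) (c : ℚ) :
    ∀ F : MvPolynomial ι ℚ,
      L.foldl (fun (F : MvPolynomial ι ℚ) (d : ι → ℕ) => ∑ l, (d l : ℚ) • pderiv l F) (c • F) =
        c • L.foldl (fun (F : MvPolynomial ι ℚ) (d : ι → ℕ) => ∑ l, (d l : ℚ) • pderiv l F) F := by
  induction L with
  | nil => intro F; rfl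
  | cons d L ih =>
    intro F
    rw [List.foldl_cons, List.foldl_cons, ← ih]
    congr 1
    simp only [Finset.smul_sum]
    refine Finset.sum_congr rfl fun l _ => ?_
    rw [MvPolynomial.smul_eq_C_mul F c, pderiv_C_mul, ← MvPolynomial.smul_eq_C_mul, smul_comm]

/-- **The full fold of `F₀ = Π_l T_l^{a_l}/a_l!` is the mixed Bézout number**: for
`|a| = r`, `(L_{δ_r} ∘ ⋯ ∘ L_{δ_1})(T^a/a!) = [T^a] Π_j (Σ_l δ_{j,l} T_l)` (a constant).
[folklore] -/
theorem coeff_zero_foldl_divPowMonomial {r : ℕ} (δ : Fin r → ι → ℕ) (a : ι →₀ ℕ)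
    (ha : a.degree = r) :
    coeff 0 ((List.ofFn δ).foldl
        (fun (F : MvPolynomial ι ℚ) (d : ι → ℕ) => ∑ l, (d l : ℚ) • pderiv l F)
        (monomial a ((∏ l, ((a l).factorial : ℚ))⁻¹))) =
      ((coeff a (∏ j, ∑ l, δ j l • (X l : MvPolynomial ι ℕ)) : ℕ) : ℚ) := by
  have hmono : (monomial a ((∏ l, ((a l).factorial : ℚ))⁻¹) : MvPolynomial ι ℚ) =
      ((∏ l, ((a l).factorial : ℚ))⁻¹) • monomial a 1 := by
    rw [smul_monomial, smul_eq_mul, mul_one]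
  rw [hmono, foldl_smul, iterDirDeriv_monomial (List.ofFn δ) a (by rw [List.length_ofFn]; exact ha),
    coeff_smul, coeff_C, if_pos rfl, smul_eq_mul]
  -- `Π (a_l!)⁻¹ · a! = 1`
  have hfac : ((a.prod fun _ k => k.factorial : ℕ) : ℚ) = ∏ l, ((a l).factorial : ℚ) := by
    rw [Finsupp.prod_fintype _ _ (fun _ => Nat.factorial_zero), Nat.cast_prod]
  have hne : (∏ l, ((a l).factorial : ℚ)) ≠ 0 :=
    Finset.prod_ne_zero_iff.mpr fun l _ => by exact_mod_cast (a l).factorial_ne_zero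
  rw [hfac, ← mul_assoc, inv_mul_cancel₀ hne, one_mul]
  -- the product of linear forms over `ℕ` and over `ℚ`
  rw [List.map_ofFn, List.prod_ofFn]
  have hmap : (∏ j, ∑ l, (δ j l : ℚ) • (X l : MvPolynomial ι ℚ)) =
      MvPolynomial.map (Nat.castRingHom ℚ) (∏ j, ∑ l, δ j l • (X l : MvPolynomial ι ℕ)) := by
    rw [map_prod]
    refine Finset.prod_congr rfl fun j _ => ?_
    rw [map_sum]
    refine Finset.sum_congr rfl fun l _ => ?_
    rw [map_nsmul, map_X, Nat.cast_smul_eq_nsmul]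
  change coeff a (∏ j, ∑ l, (δ j l : ℚ) • (X l : MvPolynomial ι ℚ)) = _
  rw [hmap, coeff_map]
  simp

/-! ## The polynomial ring: base case -/

/-- **Base case**: the Hilbert polynomial `P₀ = Π_l p_{n_l}(T_l)` of the polynomial ring has
`deg ≤ r = Σ_l (n_l - 1)` and its degree-`r` coefficients are those of
`F₀ = Π_l T_l^{n_l - 1}/(n_l - 1)!`. [folklore] -/
theorem coeff_basePolynomial_eq (s : ι → ℕ) (α : ι →₀ ℕ)
    (hα : α.degree = ∑ l, (s l - 1)) :
    coeff α (∏ l, Polynomial.aeval (X l : MvPolynomial ι ℚ)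
        ((Polynomial.C ((((s l - 1).factorial : ℕ) : ℚ)⁻¹) *
          (ascPochhammer ℚ (s l - 1)).comp (Polynomial.X + 1)).comp
            (Polynomial.X - Polynomial.C ((0 : ℕ) : ℚ)))) =
      coeff α (monomial (Finsupp.equivFunOnFinite.symm fun l => s l - 1)
        ((∏ l, (((s l - 1).factorial : ℕ) : ℚ))⁻¹) : MvPolynomial ι ℚ) := by
  classical
  obtain ⟨-, -, hnonneg⟩ := coeff_orthantPolynomial s (fun _ => 0)
  rw [coeff_prod_aeval_X, coeff_monomial]
  have hdeg : ∀ l, ((Polynomial.C ((((s l - 1).factorial : ℕ) : ℚ)⁻¹) *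
      (ascPochhammer ℚ (s l - 1)).comp (Polynomial.X + 1)).comp
        (Polynomial.X - Polynomial.C ((0 : ℕ) : ℚ))).natDegree = s l - 1 := fun l =>
    (natDegree_leadingCoeff_binomialPolynomial_comp (s l) 0).1
  have hlc : ∀ l, ((Polynomial.C ((((s l - 1).factorial : ℕ) : ℚ)⁻¹) *
      (ascPochhammer ℚ (s l - 1)).comp (Polynomial.X + 1)).comp
        (Polynomial.X - Polynomial.C ((0 : ℕ) : ℚ))).leadingCoeff =
          ((((s l - 1).factorial : ℕ) : ℚ)⁻¹) := fun l =>
    (natDegree_leadingCoeff_binomialPolynomial_comp (s l) 0).2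
  by_cases hall : ∀ l, α l ≤ s l - 1
  · have heq : ∀ l, α l = s l - 1 := by
      intro l
      by_contra hne
      have hlt : α l < s l - 1 := lt_of_le_of_ne (hall l) hne
      have : ∑ l, α l < ∑ l, (s l - 1) :=
        Finset.sum_lt_sum (fun l _ => hall l) ⟨l, mem_univ l, hlt⟩
      rw [Finsupp.degree_eq_sum] at hα
      omega
    have hαeq : Finsupp.equivFunOnFinite.symm (fun l => s l - 1) = α := by
      ext l
      simp [heq l]
    rw [if_pos hαeq, ← Finset.prod_inv_distrib]
    refine Finset.prod_congr rfl fun l _ => ?_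
    have h := hlc l
    rw [Polynomial.leadingCoeff, hdeg l] at h
    rw [heq l]
    exact h
  · push Not at hall
    obtain ⟨l, hl⟩ := hall
    rw [Finset.prod_eq_zero (mem_univ l)
      (Polynomial.coeff_eq_zero_of_natDegree_lt (by rw [hdeg l]; exact hl)), if_neg]
    intro h
    have := congr_arg (fun f => f l) (congr_arg DFunLike.coe h)
    simp only [Finsupp.coe_equivFunOnFinite_symm] at this
    omega

/-! ## Hilbert-function forms of the identities of `MultigradedHilbertFunction.lean` -/

section Hilb

variable {K : Type*} [Field K] {n : ℕ}

omit [Fintype ι] [DecidableEq ι] in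
/-- `H` is antitone in the ideal. [folklore] -/
theorem hilb_antitone (w : Fin n → ι → ℕ) {I J : Ideal (MvPolynomial (Fin n) K)} (h : I ≤ J)
    (t : ι → ℕ) [Module.Finite K (weightedHomogeneousSubmodule K w t)] :
    finrank K (weightedHomogeneousSubmodule K w t) -
        finrank K ↥(Submodule.restrictScalars K J ⊓ weightedHomogeneousSubmodule K w t) ≤
      finrank K (weightedHomogeneousSubmodule K w t) -
        finrank K ↥(Submodule.restrictScalars K I ⊓ weightedHomogeneousSubmodule K w t) :=
  Nat.sub_le_sub_left (finrank_wpiece_mono w h t) _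

omit [DecidableEq ι] in
/-- Hilbert-function form of the lattice identity: `H(I ∩ J) + H(I + J) = H(I) + H(J)`.
[folklore] -/
theorem hilb_inf_add_sup (w : Fin n → ι → ℕ) {I J : Ideal (MvPolynomial (Fin n) K)}
    (hI : ∀ p ∈ I, ∀ m, weightedHomogeneousComponent w m p ∈ I)
    (hJ : ∀ p ∈ J, ∀ m, weightedHomogeneousComponent w m p ∈ J) (t : ι → ℕ)
    [Module.Finite K (weightedHomogeneousSubmodule K w t)] :
    (finrank K (weightedHomogeneousSubmodule K w t) -
        finrank K ↥(Submodule.restrictScalars K (I ⊓ J) ⊓ weightedHomogeneousSubmodule K w t)) +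
      (finrank K (weightedHomogeneousSubmodule K w t) -
        finrank K ↥(Submodule.restrictScalars K (I ⊔ J) ⊓ weightedHomogeneousSubmodule K w t)) =
      (finrank K (weightedHomogeneousSubmodule K w t) -
        finrank K ↥(Submodule.restrictScalars K I ⊓ weightedHomogeneousSubmodule K w t)) +
      (finrank K (weightedHomogeneousSubmodule K w t) -
        finrank K ↥(Submodule.restrictScalars K J ⊓ weightedHomogeneousSubmodule K w t)) := by
  have h := finrank_wpiece_inf_add_sup w hI hJ t
  have h1 := finrank_wpiece_le w I t
  have h2 := finrank_wpiece_le w J t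
  have h3 := finrank_wpiece_le w (I ⊔ J) t
  have h4 := finrank_wpiece_le w (I ⊓ J) t
  omega

omit [DecidableEq ι] in
/-- Hilbert-function form of the non-zero-divisor formula:
`H(I + (Q); t) = H(I; t) - H(I; t - q)` for `t ≥ q`. [folklore] -/
theorem hilb_sup_span_eq_sub [IsCancelAdd (ι → ℕ)] (w : Fin n → ι → ℕ)
    {I : Ideal (MvPolynomial (Fin n) K)}
    (hI : ∀ p ∈ I, ∀ m, weightedHomogeneousComponent w m p ∈ I) {Q : MvPolynomial (Fin n) K}
    (hQ0 : Q ≠ 0) {q : ι → ℕ} (hQ : Q.IsWeightedHomogeneous w q)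
    (hnzd : ∀ f, Q * f ∈ I → f ∈ I) (t : ι → ℕ) (hqt : q ≤ t)
    [∀ t, Module.Finite K (weightedHomogeneousSubmodule K w t)] :
    finrank K (weightedHomogeneousSubmodule K w t) -
        finrank K ↥(Submodule.restrictScalars K (I ⊔ Ideal.span {Q}) ⊓
          weightedHomogeneousSubmodule K w t) =
      (finrank K (weightedHomogeneousSubmodule K w t) -
        finrank K ↥(Submodule.restrictScalars K I ⊓ weightedHomogeneousSubmodule K w t)) -
      (finrank K (weightedHomogeneousSubmodule K w (t - q)) -
        finrank K ↥(Submodule.restrictScalars K I ⊓ weightedHomogeneousSubmodule K w (t - q))) := by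
  have ht : t - q + q = t := tsub_add_cancel_of_le hqt
  have h := finrank_wpiece_sup_span_add_eq w hI hQ0 hQ hnzd (t - q)
  rw [ht] at h
  have h1 := finrank_wpiece_le w I t
  have h2 := finrank_wpiece_le w I (t - q)
  have h3 := finrank_wpiece_le w (I ⊔ Ideal.span {Q}) t
  omega

end Hilb

/-! ## The count -/

/-- **Multigraded refined Bézout count** (Fulton, *Intersection Theory*, Ex. 12.3.1 / Thm. 12.3;
van der Waerden 1928): let `S = K[X_0, …, X_{n-1}]` be multigraded by the blocks of
`blk : Fin n → ι` (all non-empty, `r + |ι| = n`), let `Q_1, …, Q_r` be non-zero multihomogeneous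
forms of multidegrees `δ_j`, and let `𝓟` be a finite set of MINIMAL primes of `(Q_1, …, Q_r)` of
dimension `|ι|` whose intersection has Hilbert function eventually `|𝓟|`. Then
`|𝓟| ≤ [T^{(n_l - 1)_l}] Π_j (Σ_l δ_{j,l} T_l)`. [cite: Fulton1998, Example 12.3.1] -/
theorem card_le_mixedBezout {K : Type*} [Field K] {n r : ℕ} (blk : Fin n → ι)
    (hblk : ∀ l, 1 ≤ ((univ : Finset (Fin n)).filter (fun i => blk i = l)).card)
    (hr : r + Fintype.card ι = n)
    (Q : Fin r → MvPolynomial (Fin n) K) (δ : Fin r → ι → ℕ)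
    (hQ : ∀ j, (Q j).IsWeightedHomogeneous (fun i => (Pi.single (blk i) 1 : ι → ℕ)) (δ j))
    (hQ0 : ∀ j, Q j ≠ 0)
    (𝓟 : Finset (Ideal (MvPolynomial (Fin n) K)))
    (h𝓟 : ∀ 𝔓 ∈ 𝓟, 𝔓 ∈ (Ideal.span (Set.range Q)).minimalPrimes ∧
      ringKrullDim (MvPolynomial (Fin n) K ⧸ 𝔓) = (Fintype.card ι : ℕ))
    (hcount : ∃ t₁ : ι → ℕ, ∀ t, t₁ ≤ t →
      finrank K (weightedHomogeneousSubmodule K (fun i => (Pi.single (blk i) 1 : ι → ℕ)) t) -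
        finrank K ↥(Submodule.restrictScalars K (𝓟.inf id) ⊓
          weightedHomogeneousSubmodule K (fun i => (Pi.single (blk i) 1 : ι → ℕ)) t) = 𝓟.card) :
    𝓟.card ≤ coeff (Finsupp.equivFunOnFinite.symm fun l =>
        ((univ : Finset (Fin n)).filter (fun i => blk i = l)).card - 1)
      (∏ j, ∑ l, δ j l • (X l : MvPolynomial ι ℕ)) := by
  classical
  -- the grading, finiteness of the pieces
  set w : Fin n → ι → ℕ := fun i => Pi.single (blk i) 1 with hw_def
  have hw : ∀ i, w i ≠ 0 := fun i h => by
    have := congr_fun h (blk i)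
    simp [hw_def] at this
  haveI hfin : ∀ t, Module.Finite K (weightedHomogeneousSubmodule K w t) :=
    fun t => finite_weightedHomogeneousSubmodule_of_ne_zero w hw t
  -- block sizes and the exponent `a = (n_l - 1)_l`, `|a| = r`
  set ns : ι → ℕ := fun l => ((univ : Finset (Fin n)).filter (fun i => blk i = l)).card with hns
  have hsum_ns : ∑ l, ns l = n := by
    have h := Finset.card_eq_sum_card_fiberwise (f := blk) (s := (univ : Finset (Fin n)))
      (t := (univ : Finset ι)) fun i _ => Finset.mem_coe.mpr (mem_univ (blk i))
    rw [Finset.card_univ, Fintype.card_fin] at h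
    exact h.symm
  have hsum_a : ∑ l, (ns l - 1) = r := by
    rw [Finset.sum_tsub_distrib _ fun l _ => hblk l, hsum_ns, Finset.sum_const, smul_eq_mul, mul_one,
      Finset.card_univ]
    omega
  set a : ι →₀ ℕ := Finsupp.equivFunOnFinite.symm fun l => ns l - 1 with ha_def
  have ha_apply : ∀ l, a l = ns l - 1 := fun l => by simp [ha_def]
  have ha_deg : a.degree = r := by
    rw [Finsupp.degree_eq_sum]; simp_rw [ha_apply]; exact hsum_a
  -- the ideal and its generators
  set 𝔞 : Ideal (MvPolynomial (Fin n) K) := Ideal.span (Set.range Q) with h𝔞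
  have hQ𝔞 : ∀ j, Q j ∈ 𝔞 := fun j => Ideal.subset_span ⟨j, rfl⟩
  have h𝔞P : ∀ 𝔓 ∈ 𝓟, 𝔞 ≤ 𝔓 := fun 𝔓 h𝔓 => (h𝓟 𝔓 h𝔓).1.1.2
  -- the comparison forms `G_j = (L_{δ_j} ∘ ⋯ ∘ L_{δ_1}) F₀`
  set F₀ : MvPolynomial ι ℚ := monomial a ((∏ l, ((a l).factorial : ℚ))⁻¹) with hF₀
  have hF₀hom : F₀.IsHomogeneous r := isHomogeneous_monomial _ ha_deg
  -- MAIN INVARIANT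
  have key : ∀ j : ℕ, j ≤ r → ∃ Kj : Ideal (MvPolynomial (Fin n) K),
      (∀ p ∈ Kj, ∀ m, weightedHomogeneousComponent w m p ∈ Kj) ∧
      (∀ 𝔓 ∈ 𝓟, Kj ≤ 𝔓) ∧
      (∀ i : Fin r, (i : ℕ) < j → Q i ∈ Kj) ∧
      (∀ 𝔮 ∈ Kj.minimalPrimes, ringKrullDim (MvPolynomial (Fin n) K ⧸ 𝔮) = (n - j : ℕ)) ∧
      ∃ (P : MvPolynomial ι ℚ) (t₀ : ι → ℕ),
        (∀ t : ι → ℕ, t₀ ≤ t →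
          ((finrank K (weightedHomogeneousSubmodule K w t) -
            finrank K ↥(Submodule.restrictScalars K Kj ⊓ weightedHomogeneousSubmodule K w t) : ℕ)
              : ℚ) = MvPolynomial.eval (fun l => (t l : ℚ)) P) ∧
        P.totalDegree ≤ r - j ∧
        ∀ α : ι →₀ ℕ, α.degree = r - j → coeff α P ≤ coeff α
          (((List.ofFn δ).take j).foldl
            (fun (F : MvPolynomial ι ℚ) (d : ι → ℕ) => ∑ l, (d l : ℚ) • pderiv l F) F₀) := by
    intro j
    induction j with
    | zero =>
      intro _
      refine ⟨⊥, ?_, fun 𝔓 _ => bot_le, fun i hi => absurd hi (Nat.not_lt_zero _), ?_, ?_⟩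
      · intro p hp m
        rw [Ideal.mem_bot] at hp
        rw [hp, map_zero]
        exact Ideal.zero_mem _
      · intro 𝔮 h𝔮
        rw [Ideal.minimalPrimes_eq_subsingleton_self, Set.mem_singleton_iff] at h𝔮
        rw [h𝔮, Nat.sub_zero, ringKrullDim_eq_of_ringEquiv (RingEquiv.quotientBot _),
          ringKrullDim_mvPolynomial_fin]
      · refine ⟨∏ l, Polynomial.aeval (X l : MvPolynomial ι ℚ)
          ((Polynomial.C ((((ns l - 1).factorial : ℕ) : ℚ)⁻¹) *
            (ascPochhammer ℚ (ns l - 1)).comp (Polynomial.X + 1)).comp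
              (Polynomial.X - Polynomial.C ((0 : ℕ) : ℚ))), 0, fun t _ => ?_, ?_, ?_⟩
        · exact hilbert_bot_eq_eval blk hblk t
        · rw [Nat.sub_zero, ← hsum_a]
          exact (coeff_orthantPolynomial ns (fun _ => 0)).1
        · intro α hα
          rw [Nat.sub_zero] at hα
          rw [List.take_zero, List.foldl_nil, coeff_basePolynomial_eq ns α (by rw [hα, hsum_a])]
          apply le_of_eq
          rw [hF₀]
          try rfl
    | succ j ih =>
      intro hj1
      have hjr : j < r := Nat.lt_of_succ_le hj1
      obtain ⟨Kj, hCC, hleP, hQmem, hdimq, P, t₀, hP, hPdeg, hPcoeff⟩ := ih hjr.le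
      -- the next cut
      set Q' := Q ⟨j, hjr⟩ with hQ'
      set δ' := δ ⟨j, hjr⟩ with hδ'
      have hQ'w : Q'.IsWeightedHomogeneous w δ' := hQ ⟨j, hjr⟩
      have hQ'0 : Q' ≠ 0 := hQ0 ⟨j, hjr⟩
      -- saturation `K̃ = (Kj : Q'^∞)`
      obtain ⟨N, hmemN, hnzd1, hKle, hKeq, hnzdj⟩ := exists_saturation Kj Q'
      set Ktil := Kj.colon {Q' ^ N} with hKtil
      have hCCtil : ∀ p ∈ Ktil, ∀ m, weightedHomogeneousComponent w m p ∈ Ktil := by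
        intro p hp m
        obtain ⟨M, hM⟩ := (hmemN p).mp hp
        refine (hmemN _).mpr ⟨M, ?_⟩
        rw [mul_comm] at hM ⊢
        exact weightedHomogeneousComponent_mem_colon_pow w hCC hQ'w M hM m
      have hnzdN : ∀ (k : ℕ) (f : MvPolynomial (Fin n) K), Q' ^ k * f ∈ Ktil → f ∈ Ktil :=
        fun k f hf => hnzdj k f (by rw [mul_comm]; exact hf)
      -- `K̃` stays inside every target: `Q' ∉ 𝔮` for the minimal primes `𝔮` of `Kj` inside `𝔓`
      have hKtilP : ∀ 𝔓 ∈ 𝓟, Ktil ≤ 𝔓 := by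
        intro 𝔓 h𝔓
        obtain ⟨h𝔓min, h𝔓dim⟩ := h𝓟 𝔓 h𝔓
        haveI : 𝔓.IsPrime := h𝔓min.1.1
        obtain ⟨𝔮, h𝔮min, h𝔮le⟩ := Ideal.exists_minimalPrimes_le (hleP 𝔓 h𝔓)
        haveI h𝔮prime : 𝔮.IsPrime := h𝔮min.1.1
        -- the remaining cuts `Q_{j+1}, …, Q_{r-1}`
        set L : List (MvPolynomial (Fin n) K) :=
          List.ofFn fun i : Fin (r - (j + 1)) => Q ⟨j + 1 + i, by omega⟩ with hL
        have hLmem : ∀ y ∈ L, y ∈ 𝔓 := by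
          intro y hy
          rw [hL, List.mem_ofFn] at hy
          obtain ⟨i, rfl⟩ := hy
          exact h𝔞P 𝔓 h𝔓 (hQ𝔞 _)
        have hgen : ∀ 𝔮' : Ideal (MvPolynomial (Fin n) K), 𝔮'.IsPrime → 𝔮 ≤ 𝔮' → Q' ∈ 𝔮' →
            (∀ y ∈ L, y ∈ 𝔮') → 𝔞 ≤ 𝔮' := by
          intro 𝔮' _ h𝔮𝔮' hQ'𝔮' hL𝔮'
          rw [h𝔞, Ideal.span_le]
          rintro _ ⟨i, rfl⟩
          rcases Nat.lt_trichotomy (i : ℕ) j with hlt | heq | hgt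
          · exact h𝔮𝔮' (h𝔮min.1.2 (hQmem i hlt))
          · have : i = ⟨j, hjr⟩ := Fin.ext heq
            rw [this]; exact hQ'𝔮'
          · apply hL𝔮'
            rw [hL, List.mem_ofFn]
            refine ⟨⟨(i : ℕ) - (j + 1), by omega⟩, ?_⟩
            congr 1
            exact Fin.ext (by simp; omega)
        have hQ'𝔮 : Q' ∉ 𝔮 :=
          not_mem_of_mem_minimalPrimes_of_lt h𝔓min h𝔮le hLmem hgen (hdimq 𝔮 h𝔮min) h𝔓dim
            (by rw [hL, List.length_ofFn]; omega)
        intro x hx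
        obtain ⟨M, hM⟩ := (hmemN x).mp hx
        have hx𝔮 : x ∈ 𝔮 := (h𝔮prime.mem_or_mem (h𝔮min.1.2 hM)).resolve_right
          fun h => hQ'𝔮 (h𝔮prime.mem_of_pow_mem M h)
        exact h𝔮le hx𝔮
      -- minimal primes of `K̃`
      have hdimtil : ∀ 𝔮 ∈ Ktil.minimalPrimes,
          ringKrullDim (MvPolynomial (Fin n) K ⧸ 𝔮) = (n - j : ℕ) ∧ Q' ∉ 𝔮 := by
        intro 𝔮 h𝔮
        obtain ⟨h1, h2⟩ := mem_minimalPrimes_of_mem_minimalPrimes_saturation hKle hmemN hnzd1 h𝔮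
        exact ⟨hdimq 𝔮 h1, h2⟩
      -- the next ideal `K' = K̃ + (Q')`
      refine ⟨Ktil ⊔ Ideal.span {Q'}, ?_, ?_, ?_, ?_, ?_⟩
      · exact weightedHomogeneousComponent_mem_sup w hCCtil
          (weightedHomogeneousComponent_mem_span_singleton w hQ'w)
      · intro 𝔓 h𝔓
        exact sup_le (hKtilP 𝔓 h𝔓)
          ((Ideal.span_singleton_le_iff_mem _).mpr (h𝔞P 𝔓 h𝔓 (hQ𝔞 _)))
      · intro i hi
        rcases Nat.lt_succ_iff_lt_or_eq.mp hi with hlt | heq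
        · exact Ideal.mem_sup_left (hKle (hQmem i hlt))
        · have : i = ⟨j, hjr⟩ := Fin.ext heq
          rw [this]
          exact Ideal.mem_sup_right (Ideal.mem_span_singleton_self _)
      · intro 𝔮'' h𝔮''
        have h𝔮''prime : 𝔮''.IsPrime := h𝔮''.1.1
        obtain ⟨𝔮', h𝔮'min, h𝔮'le⟩ :=
          Ideal.exists_minimalPrimes_le (le_sup_left.trans h𝔮''.1.2 : Ktil ≤ 𝔮'')
        obtain ⟨h𝔮'dim, hQ'𝔮'⟩ := hdimtil 𝔮' h𝔮'min
        haveI : 𝔮'.IsPrime := h𝔮'min.1.1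
        have hmin : 𝔮'' ∈ (𝔮' ⊔ Ideal.span {Q'}).minimalPrimes := by
          refine ⟨⟨h𝔮''prime, sup_le h𝔮'le (le_sup_right.trans h𝔮''.1.2)⟩, ?_⟩
          intro P' hP' hP'le
          exact h𝔮''.2 ⟨hP'.1, (sup_le_sup_right h𝔮'min.1.2 _).trans hP'.2⟩ hP'le
        have h := ringKrullDim_quotient_add_one_of_mem_minimalPrimes_sup_span hQ'𝔮' hmin
        rw [h𝔮'dim, show ((n - j : ℕ) : WithBot ℕ∞) = ((n - (j + 1) : ℕ) : WithBot ℕ∞) + 1 by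
          rw [← Nat.cast_one (R := WithBot ℕ∞), ← Nat.cast_add]; congr 1; omega] at h
        exact ENat.WithBot.add_one_cancel.mp h
      · -- HILBERT DATA of `K'`
        have hk : 1 ≤ r - j := by omega
        -- polynomials of `K̃` and of `Kj + (Q'^N)` (the latter with non-negative top form)
        obtain ⟨Ptil, ttil, hPtil, -⟩ := exists_hilbertMvPolynomial blk Ktil hCCtil
        have hQ'Nw : (Q' ^ N).IsWeightedHomogeneous w (N • δ') := hQ'w.pow N
        have hCC₂ : ∀ p ∈ Kj ⊔ Ideal.span {Q' ^ N}, ∀ m,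
            weightedHomogeneousComponent w m p ∈ Kj ⊔ Ideal.span {Q' ^ N} :=
          weightedHomogeneousComponent_mem_sup w hCC
            (weightedHomogeneousComponent_mem_span_singleton w hQ'Nw)
        obtain ⟨P₂, t₂, hP₂, hpos₂⟩ := exists_hilbertMvPolynomial blk (Kj ⊔ Ideal.span {Q' ^ N}) hCC₂
        -- a common threshold
        set qN : ι → ℕ := N • δ' with hqN
        set T : ι → ℕ := t₀ + ttil + t₂ + qN + δ' with hT
        have hTle : ∀ t : ι → ℕ, T ≤ t → ∀ l, t₀ l + ttil l + t₂ l + qN l + δ' l ≤ t l := by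
          intro t ht l
          have h := ht l
          simp only [hT, Pi.add_apply] at h
          exact h
        have hT₀ : ∀ t : ι → ℕ, T ≤ t → t₀ ≤ t := fun t ht l => by
          have h := hTle t ht l
          show t₀ l ≤ t l
          omega
        have hTtil : ∀ t : ι → ℕ, T ≤ t → ttil ≤ t := fun t ht l => by
          have h := hTle t ht l
          show ttil l ≤ t l
          omega
        have hT₂ : ∀ t : ι → ℕ, T ≤ t → t₂ ≤ t := fun t ht l => by
          have h := hTle t ht l
          show t₂ l ≤ t l
          omega
        have hTqN : ∀ t : ι → ℕ, T ≤ t → qN ≤ t := fun t ht l => by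
          have h := hTle t ht l
          show qN l ≤ t l
          omega
        have hTδ : ∀ t : ι → ℕ, T ≤ t → δ' ≤ t := fun t ht l => by
          have h := hTle t ht l
          show δ' l ≤ t l
          omega
        have hTtilq : ∀ t : ι → ℕ, T ≤ t → ttil ≤ t - qN := fun t ht l => by
          have h := hTle t ht l
          show ttil l ≤ t l - qN l
          omega
        have hTtilδ : ∀ t : ι → ℕ, T ≤ t → ttil ≤ t - δ' := fun t ht l => by
          have h := hTle t ht l
          show ttil l ≤ t l - δ' l
          omega
        -- casts of shifted arguments
        have hcast : ∀ (q t : ι → ℕ), q ≤ t →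
            (fun l => (t l : ℚ) - (q l : ℚ)) = fun l => (((t - q) l : ℕ) : ℚ) := by
          intro q t hqt
          funext l
          rw [Pi.sub_apply, Nat.cast_sub (hqt l)]
        -- the difference formulas: `H(K̃ + (Q'^N)) = H(K̃) - H(K̃)(· - Nδ')`, `H(K') = H(K̃) - H(K̃)(· - δ')`
        have hdiffN : ∀ t, T ≤ t →
            ((finrank K (weightedHomogeneousSubmodule K w t) -
              finrank K ↥(Submodule.restrictScalars K (Ktil ⊔ Ideal.span {Q' ^ N}) ⊓
                weightedHomogeneousSubmodule K w t) : ℕ) : ℚ) =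
            MvPolynomial.eval (fun l => (t l : ℚ)) Ptil -
              MvPolynomial.eval (fun l => (t l : ℚ)) (aeval (fun l => X l - C (qN l : ℚ)) Ptil) := by
          intro t ht
          rw [hilb_sup_span_eq_sub w hCCtil (pow_ne_zero N hQ'0) hQ'Nw (hnzdN N) t (hTqN t ht),
            eval_shift_sub, hcast qN t (hTqN t ht), ← hPtil _ (hTtilq t ht), ← hPtil _ (hTtil t ht),
            Nat.cast_sub]
          -- `H(K̃)(t - Nδ') ≤ H(K̃)(t)` from the same formula
          have h := finrank_wpiece_sup_span_add_eq w hCCtil (pow_ne_zero N hQ'0) hQ'Nw (hnzdN N) (t - qN)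
          rw [tsub_add_cancel_of_le (hTqN t ht)] at h
          have h1 := finrank_wpiece_le w Ktil t
          have h2 := finrank_wpiece_le w Ktil (t - qN)
          have h3 := finrank_wpiece_le w (Ktil ⊔ Ideal.span {Q' ^ N}) t
          omega
        have hdiff1 : ∀ t, T ≤ t →
            ((finrank K (weightedHomogeneousSubmodule K w t) -
              finrank K ↥(Submodule.restrictScalars K (Ktil ⊔ Ideal.span {Q'}) ⊓
                weightedHomogeneousSubmodule K w t) : ℕ) : ℚ) =
            MvPolynomial.eval (fun l => (t l : ℚ)) Ptil -
              MvPolynomial.eval (fun l => (t l : ℚ)) (aeval (fun l => X l - C (δ' l : ℚ)) Ptil) := by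
          intro t ht
          have hnzd' : ∀ f, Q' * f ∈ Ktil → f ∈ Ktil := fun f hf => hnzdN 1 f (by rw [pow_one]; exact hf)
          rw [hilb_sup_span_eq_sub w hCCtil hQ'0 hQ'w hnzd' t (hTδ t ht),
            eval_shift_sub, hcast δ' t (hTδ t ht), ← hPtil _ (hTtilδ t ht), ← hPtil _ (hTtil t ht),
            Nat.cast_sub]
          have h := finrank_wpiece_sup_span_add_eq w hCCtil hQ'0 hQ'w hnzd' (t - δ')
          rw [tsub_add_cancel_of_le (hTδ t ht)] at h
          have h1 := finrank_wpiece_le w Ktil t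
          have h2 := finrank_wpiece_le w Ktil (t - δ')
          have h3 := finrank_wpiece_le w (Ktil ⊔ Ideal.span {Q'}) t
          omega
        -- the lattice identity `P̃ + P₂ = P + P₃`, `P₃ = P̃ - P̃(T - Nδ')`
        have hid : Ptil + P₂ = P + (Ptil - aeval (fun l => X l - C (qN l : ℚ)) Ptil) := by
          refine eq_of_eval_natCast_eq T fun t ht => ?_
          rw [map_add, map_add, ← hPtil t (hTtil t ht), ← hP₂ t (hT₂ t ht), ← hP t (hT₀ t ht),
            map_sub, ← hdiffN t ht]
          have h := hilb_inf_add_sup w hCCtil hCC₂ t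
          rw [← hKeq, show Ktil ⊔ (Kj ⊔ Ideal.span {Q' ^ N}) = Ktil ⊔ Ideal.span {Q' ^ N} by
            rw [← sup_assoc, sup_eq_left.mpr hKle]] at h
          exact_mod_cast h.symm
        -- degrees
        have hilb_le : ∀ (I J : Ideal (MvPolynomial (Fin n) K)), I ≤ J → ∀ t : ι → ℕ,
            (0 : ℚ) ≤ ((finrank K (weightedHomogeneousSubmodule K w t) -
              finrank K ↥(Submodule.restrictScalars K J ⊓ weightedHomogeneousSubmodule K w t) : ℕ)
                : ℚ) ∧
            (((finrank K (weightedHomogeneousSubmodule K w t) -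
              finrank K ↥(Submodule.restrictScalars K J ⊓ weightedHomogeneousSubmodule K w t) : ℕ)
                : ℚ)) ≤
            ((finrank K (weightedHomogeneousSubmodule K w t) -
              finrank K ↥(Submodule.restrictScalars K I ⊓ weightedHomogeneousSubmodule K w t) : ℕ)
                : ℚ) := by
          intro I J hIJ t
          exact ⟨Nat.cast_nonneg _, by exact_mod_cast hilb_antitone w hIJ t⟩
        have hPtildeg : Ptil.totalDegree ≤ r - j := by
          refine (totalDegree_le_of_eventually_le T fun t ht => ?_).trans hPdeg
          rw [← hPtil t (hTtil t ht), ← hP t (hT₀ t ht)]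
          exact hilb_le Kj Ktil hKle t
        have hP₂deg : P₂.totalDegree ≤ r - j := by
          refine (totalDegree_le_of_eventually_le T fun t ht => ?_).trans hPdeg
          rw [← hP₂ t (hT₂ t ht), ← hP t (hT₀ t ht)]
          exact hilb_le Kj _ le_sup_left t
        have hP₃deg : (Ptil - aeval (fun l => X l - C (qN l : ℚ)) Ptil).totalDegree ≤ r - j - 1 :=
          totalDegree_sub_shift_le qN hPtildeg
        -- top forms
        have hGhom : (((List.ofFn δ).take j).foldl
            (fun (F : MvPolynomial ι ℚ) (d : ι → ℕ) => ∑ l, (d l : ℚ) • pderiv l F) F₀).IsHomogeneous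
              (r - j) := isHomogeneous_foldl_take δ hF₀hom j hjr.le
        have htop := coeff_homogeneousComponent_le_of_add_eq hk hid hP₂deg hP₃deg hGhom hPcoeff hpos₂
        obtain ⟨hP'deg, hP'coeff⟩ := coeff_sub_shift_le hk hPtildeg δ' htop
        refine ⟨Ptil - aeval (fun l => X l - C (δ' l : ℚ)) Ptil, T, fun t ht => ?_, ?_, ?_⟩
        · rw [map_sub]; exact hdiff1 t ht
        · rw [show r - (j + 1) = r - j - 1 by omega]; exact hP'deg
        · intro α hα
          rw [foldl_take_succ δ F₀ hjr]
          exact hP'coeff α (by rw [hα]; omega)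
  -- CONCLUSION from the invariant at `j = r`
  obtain ⟨Kr, -, hleP, -, -, P, t₀, hP, hPdeg, hPcoeff⟩ := key r le_rfl
  obtain ⟨t₁, ht₁⟩ := hcount
  have hPconst : P = C (coeff 0 P) := totalDegree_eq_zero_iff_eq_C.mp (by
    have : r - r = 0 := Nat.sub_self r
    omega)
  have hcoeff0 : coeff 0 P ≤ ((coeff a (∏ j, ∑ l, δ j l • (X l : MvPolynomial ι ℕ)) : ℕ) : ℚ) := by
    have h := hPcoeff 0 (by rw [Nat.sub_self]; rfl)
    rw [List.take_of_length_le (by rw [List.length_ofFn]), coeff_zero_foldl_divPowMonomial δ a ha_deg]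
      at h
    exact h
  -- `|𝓟| = H(⋂𝓟)(t) ≤ H(K_r)(t) = P = coeff 0 P` for `t` large
  set t : ι → ℕ := t₀ + t₁ with ht
  have hKr : Kr ≤ 𝓟.inf id := Finset.le_inf fun 𝔓 h𝔓 => hleP 𝔓 h𝔓
  have h1 := ht₁ t (fun l => by simp [ht])
  have h2 := hilb_antitone w hKr t
  have h3 := hP t (fun l => by simp [ht])
  rw [hPconst, eval_C] at h3
  have h4 : ((𝓟.card : ℕ) : ℚ) ≤ coeff 0 P := by
    rw [← h3, ← h1]
    exact_mod_cast h2
  have h5 : ((𝓟.card : ℕ) : ℚ) ≤ ((coeff a (∏ j, ∑ l, δ j l • (X l : MvPolynomial ι ℕ)) : ℕ) : ℚ) :=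
    h4.trans hcoeff0
  exact_mod_cast h5

end Literature.RingTheory.MvPolynomial

/-! # Part II: isolated points of a multihomogeneous system -/

namespace Literature.RingTheory.MvPolynomial

section MultiCone

variable {K : Type*} [Field K] {ι : Type*} [Fintype ι] [DecidableEq ι] {n : ℕ}

/-! ## The multi-cone substitution `X_i ↦ z_i T_{blk i}` -/

omit [Fintype ι] [DecidableEq ι] in
/-- Values of the multi-cone substitution: `(ψ_z g)(τ) = g((τ_{blk i} z_i)_i)`. [folklore] -/
theorem eval_multiConeSubst (blk : Fin n → ι) (z : Fin n → K) (g : MvPolynomial (Fin n) K)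
    (τ : ι → K) :
    MvPolynomial.eval τ (MvPolynomial.eval₂Hom (C : K →+* MvPolynomial ι K)
      (fun i => C (z i) * X (blk i)) g) = MvPolynomial.eval (fun i => τ (blk i) * z i) g := by
  induction g using MvPolynomial.induction_on with
  | C a => simp
  | add p q hp hq => simp only [map_add, hp, hq]
  | mul_X p i hp =>
    simp only [map_mul, hp, MvPolynomial.eval₂Hom_X', MvPolynomial.eval_X, MvPolynomial.eval_C]
    ring

/-- **The multi-cone substitution of a multihomogeneous `g` of multidegree `t` is
`g(z) · T^t`.** [folklore] -/
theorem multiConeSubst_of_isWeightedHomogeneous (blk : Fin n → ι) (z : Fin n → K)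
    {g : MvPolynomial (Fin n) K} {t : ι → ℕ}
    (hg : g.IsWeightedHomogeneous (fun i => (Pi.single (blk i) 1 : ι → ℕ)) t) :
    MvPolynomial.eval₂Hom (C : K →+* MvPolynomial ι K) (fun i => C (z i) * X (blk i)) g =
      C (MvPolynomial.eval z g) * monomial (Finsupp.equivFunOnFinite.symm t) 1 := by
  classical
  have hmono : ∀ s ∈ g.support, MvPolynomial.eval₂Hom (C : K →+* MvPolynomial ι K)
      (fun i => C (z i) * X (blk i)) (monomial s (coeff s g)) =
      C (coeff s g * ∏ i, z i ^ s i) * monomial (Finsupp.equivFunOnFinite.symm t) 1 := by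
    intro s hs
    have hst : Finsupp.weight (fun i => (Pi.single (blk i) 1 : ι → ℕ)) s = t :=
      hg (mem_support_iff.mp hs)
    rw [MvPolynomial.eval₂Hom_monomial, Finsupp.prod_fintype _ _ (fun i => pow_zero _)]
    simp_rw [mul_pow, Finset.prod_mul_distrib, ← map_pow, ← map_prod]
    rw [← mul_assoc, ← map_mul]
    congr 1
    -- `Π_i X_{blk i}^{s_i} = T^t`
    rw [← Finset.prod_fiberwise_of_maps_to (g := blk) (fun i _ => mem_univ (blk i))]
    have hl : ∀ l, ∏ i ∈ (univ : Finset (Fin n)).filter (fun i => blk i = l),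
        (X (blk i) : MvPolynomial ι K) ^ s i = X l ^ t l := by
      intro l
      rw [← hst, weight_blockWeight_apply, Finset.prod_congr rfl fun i hi => by
        rw [(mem_filter.mp hi).2], Finset.prod_pow_eq_pow_sum]
    simp_rw [hl]
    exact prod_X_pow_eq_monomial_equivFunOnFinite t
  conv_lhs => rw [g.as_sum]
  rw [map_sum, Finset.sum_congr rfl hmono, ← Finset.sum_mul, ← map_sum, MvPolynomial.eval_eq']

/-- Hence **a multihomogeneous `g` lies in `𝔓_z` iff `g(z) = 0`.** [folklore] -/
theorem mem_ker_multiConeSubst_iff_of_isWeightedHomogeneous (blk : Fin n → ι) (z : Fin n → K)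
    {g : MvPolynomial (Fin n) K} {t : ι → ℕ}
    (hg : g.IsWeightedHomogeneous (fun i => (Pi.single (blk i) 1 : ι → ℕ)) t) :
    g ∈ RingHom.ker (MvPolynomial.eval₂Hom (C : K →+* MvPolynomial ι K)
      (fun i => C (z i) * X (blk i))) ↔ MvPolynomial.eval z g = 0 := by
  classical
  rw [RingHom.mem_ker, multiConeSubst_of_isWeightedHomogeneous blk z hg, mul_eq_zero,
    C_eq_zero, monomial_eq_zero]
  simp

omit [Fintype ι] [DecidableEq ι] in
/-- Elements of `𝔓_z` vanish on the torus orbit of `z`. [folklore] -/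
theorem eval_torusSmul_eq_zero_of_mem_ker (blk : Fin n → ι) {z : Fin n → K}
    {g : MvPolynomial (Fin n) K}
    (hg : g ∈ RingHom.ker (MvPolynomial.eval₂Hom (C : K →+* MvPolynomial ι K)
      (fun i => C (z i) * X (blk i)))) (τ : ι → K) :
    MvPolynomial.eval (fun i => τ (blk i) * z i) g = 0 := by
  rw [RingHom.mem_ker] at hg
  rw [← eval_multiConeSubst, hg, map_zero]

/-- **`𝔓_z` is closed under multihomogeneous components** (the substitution is graded: the
`T^m`-coefficient of `ψ_z g` is `g_m(z)`). [folklore] -/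
theorem weightedHomogeneousComponent_mem_ker_multiConeSubst (blk : Fin n → ι) (z : Fin n → K)
    {g : MvPolynomial (Fin n) K}
    (hg : g ∈ RingHom.ker (MvPolynomial.eval₂Hom (C : K →+* MvPolynomial ι K)
      (fun i => C (z i) * X (blk i)))) (m : ι → ℕ) :
    weightedHomogeneousComponent (fun i => (Pi.single (blk i) 1 : ι → ℕ)) m g ∈
      RingHom.ker (MvPolynomial.eval₂Hom (C : K →+* MvPolynomial ι K)
        (fun i => C (z i) * X (blk i))) := by
  classical
  set w : Fin n → ι → ℕ := fun i => Pi.single (blk i) 1 with hw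
  set ψ := MvPolynomial.eval₂Hom (C : K →+* MvPolynomial ι K) (fun i => C (z i) * X (blk i)) with hψ
  -- `ψ g = Σ_m g_m(z) T^m` over the finitely many weights `m` occurring in `g`
  have hfin := weightedHomogeneousComponent_finsupp (w := w) g
  have hdec : g = ∑ m' ∈ hfin.toFinset, weightedHomogeneousComponent w m' g := by
    conv_lhs => rw [← sum_weightedHomogeneousComponent w g, finsum_eq_sum _ hfin]
  have hψg : ψ g = ∑ m' ∈ hfin.toFinset,
      C (MvPolynomial.eval z (weightedHomogeneousComponent w m' g)) *
        monomial (Finsupp.equivFunOnFinite.symm m') 1 := by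
    conv_lhs => rw [hdec]
    rw [map_sum]
    exact Finset.sum_congr rfl fun m' _ => multiConeSubst_of_isWeightedHomogeneous blk z
      (weightedHomogeneousComponent_isWeightedHomogeneous m' g)
  rw [RingHom.mem_ker] at hg ⊢
  change ψ (weightedHomogeneousComponent w m g) = 0
  rw [hψ, multiConeSubst_of_isWeightedHomogeneous blk z
    (weightedHomogeneousComponent_isWeightedHomogeneous m g)]
  suffices h : MvPolynomial.eval z (weightedHomogeneousComponent w m g) = 0 by
    rw [h, C_0, zero_mul]
  -- extract the `T^m`-coefficient of `ψ g = 0`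
  by_cases hm : m ∈ hfin.toFinset
  · have h := congr_arg (coeff (Finsupp.equivFunOnFinite.symm m)) hg
    rw [hψg, coeff_sum, coeff_zero] at h
    rw [Finset.sum_eq_single m (fun m' _ hm' => by
        rw [coeff_C_mul, coeff_monomial,
          if_neg (fun heq => hm' (Finsupp.equivFunOnFinite.symm.injective heq)), mul_zero])
      (fun h' => absurd hm h')] at h
    rw [coeff_C_mul, coeff_monomial, if_pos rfl, mul_one] at h
    exact h
  · have h0 : weightedHomogeneousComponent w m g = 0 := by
      simpa [Set.Finite.mem_toFinset, Function.mem_support] using hm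
    rw [h0, map_zero]

/-! ## Dimension, zero set, distinct orbits -/

omit [Fintype ι] [DecidableEq ι] in
/-- **`ψ_z` is onto `K[T_ι]`** when `z` has a non-zero coordinate in every block. [folklore] -/
theorem multiConeSubst_surjective (blk : Fin n → ι) {z : Fin n → K}
    (hz : ∀ l, ∃ i, blk i = l ∧ z i ≠ 0) :
    Function.Surjective (MvPolynomial.eval₂Hom (C : K →+* MvPolynomial ι K)
      (fun i => C (z i) * X (blk i))) := by
  set ψ := MvPolynomial.eval₂Hom (C : K →+* MvPolynomial ι K) (fun i => C (z i) * X (blk i))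
    with hψ
  choose i hi hzi using hz
  have hX : ∀ l, ψ (C (z (i l))⁻¹ * X (i l)) = X l := by
    intro l
    simp only [hψ, map_mul, MvPolynomial.eval₂Hom_C, MvPolynomial.eval₂Hom_X', hi]
    rw [← mul_assoc, ← map_mul, inv_mul_cancel₀ (hzi l), map_one, one_mul]
  intro q
  refine ⟨MvPolynomial.eval₂ (MvPolynomial.C) (fun l => C (z (i l))⁻¹ * X (i l)) q, ?_⟩
  induction q using MvPolynomial.induction_on with
  | C a => simp [hψ]
  | add p q hp hq => rw [MvPolynomial.eval₂_add, map_add, hp, hq]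
  | mul_X p l hp => rw [MvPolynomial.eval₂_mul, MvPolynomial.eval₂_X, map_mul, hp, hX]

omit [DecidableEq ι] in
/-- **`dim S/𝔓_z = |ι|`**: `S/𝔓_z ≅ K[T_ι]`. [folklore] -/
theorem ringKrullDim_quotient_ker_multiConeSubst (blk : Fin n → ι) {z : Fin n → K}
    (hz : ∀ l, ∃ i, blk i = l ∧ z i ≠ 0) :
    ringKrullDim (MvPolynomial (Fin n) K ⧸ (RingHom.ker (MvPolynomial.eval₂Hom
      (C : K →+* MvPolynomial ι K) (fun i => C (z i) * X (blk i))) :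
        Ideal (MvPolynomial (Fin n) K))) = (Fintype.card ι : ℕ) := by
  rw [ringKrullDim_eq_of_ringEquiv
      (RingHom.quotientKerEquivOfSurjective (multiConeSubst_surjective blk hz)),
    MvPolynomial.ringKrullDim_of_isNoetherianRing, ringKrullDim_eq_zero_of_field K, zero_add,
    Nat.card_eq_fintype_card]

omit [Fintype ι] [DecidableEq ι] in
/-- The kernel `𝔓_z` is prime. [folklore] -/
theorem ker_multiConeSubst_isPrime (blk : Fin n → ι) (z : Fin n → K) :
    (RingHom.ker (MvPolynomial.eval₂Hom (C : K →+* MvPolynomial ι K)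
      (fun i => C (z i) * X (blk i)))).IsPrime :=
  RingHom.ker_isPrime _

omit [Fintype ι] [DecidableEq ι] in
/-- The elements `z_j X_i - z_i X_j` for `i, j` in the same block lie in `𝔓_z`. [folklore] -/
theorem C_mul_X_sub_mem_ker_multiConeSubst (blk : Fin n → ι) (z : Fin n → K) {i j : Fin n}
    (hij : blk i = blk j) :
    (C (z j) * X i - C (z i) * X j : MvPolynomial (Fin n) K) ∈ RingHom.ker
      (MvPolynomial.eval₂Hom (C : K →+* MvPolynomial ι K) (fun i => C (z i) * X (blk i))) := by
  rw [RingHom.mem_ker]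
  simp only [map_sub, map_mul, MvPolynomial.eval₂Hom_C, MvPolynomial.eval₂Hom_X', hij]
  ring

omit [Fintype ι] [DecidableEq ι] in
/-- **The zero set of `𝔓_z` is the torus orbit of `z`**: a common zero `y` of `𝔓_z` is
`(τ_{blk i} z_i)_i` for some `τ` (given a non-zero coordinate of `z` in every block). [folklore] -/
theorem exists_eq_torusSmul_of_forall_mem_ker (blk : Fin n → ι) {z : Fin n → K}
    (hz : ∀ l, ∃ i, blk i = l ∧ z i ≠ 0) {y : Fin n → K}
    (hy : ∀ g ∈ RingHom.ker (MvPolynomial.eval₂Hom (C : K →+* MvPolynomial ι K)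
      (fun i => C (z i) * X (blk i))), MvPolynomial.eval y g = 0) :
    ∃ τ : ι → K, y = fun i => τ (blk i) * z i := by
  choose i hi hzi using hz
  refine ⟨fun l => y (i l) * (z (i l))⁻¹, funext fun j => ?_⟩
  have h := hy _ (C_mul_X_sub_mem_ker_multiConeSubst blk z (i := i (blk j)) (j := j) (hi (blk j)))
  simp only [map_sub, map_mul, MvPolynomial.eval_C, MvPolynomial.eval_X] at h
  have hz0 := hzi (blk j)
  have h' : z (i (blk j)) * y j = y (i (blk j)) * z j := by linear_combination -h
  calc y j = (z (i (blk j)))⁻¹ * (z (i (blk j)) * y j) := by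
        rw [← mul_assoc, inv_mul_cancel₀ hz0, one_mul]
    _ = y (i (blk j)) * (z (i (blk j)))⁻¹ * z j := by rw [h']; ring

omit [Fintype ι] [DecidableEq ι] in
/-- **Distinct orbits have distinct ideals**: `𝔓_z = 𝔓_{z'}` forces `z'` into the torus orbit
of `z`. [folklore] -/
theorem exists_eq_torusSmul_of_ker_eq (blk : Fin n → ι) {z z' : Fin n → K}
    (hz : ∀ l, ∃ i, blk i = l ∧ z i ≠ 0)
    (h : RingHom.ker (MvPolynomial.eval₂Hom (C : K →+* MvPolynomial ι K)
        (fun i => C (z i) * X (blk i))) =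
      RingHom.ker (MvPolynomial.eval₂Hom (C : K →+* MvPolynomial ι K)
        (fun i => C (z' i) * X (blk i)))) :
    ∃ τ : ι → K, z' = fun i => τ (blk i) * z i := by
  refine exists_eq_torusSmul_of_forall_mem_ker blk hz fun g hg => ?_
  rw [h] at hg
  simpa using eval_torusSmul_eq_zero_of_mem_ker blk hg 1

/-! ## Isolated zeros give minimal primes -/

/-- **An isolated point of `V(𝔞) ⊂ Π_l ℙ^{n_l - 1}` is a minimal prime.** Let `K` be algebraically
closed, `𝔞 = (G)` generated by multihomogeneous forms vanishing at `z` (a point with a non-zero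
coordinate in every block), and suppose that for some polynomial `F` with `F(z) ≠ 0` every common
zero `y` of `G` with `F(y) ≠ 0` lies in the torus orbit of a point of a finite set `T` (of points
with a non-zero coordinate in every block). Then `𝔓_z` is a minimal prime of `𝔞`.
[cite: Fulton1998, Example 12.3.1] -/
theorem ker_multiConeSubst_mem_minimalPrimes_of_isolated [IsAlgClosed K] (blk : Fin n → ι)
    {z : Fin n → K} (hz : ∀ l, ∃ i, blk i = l ∧ z i ≠ 0)
    {G : Set (MvPolynomial (Fin n) K)}
    (hG : ∀ g ∈ G, ∃ t, g.IsWeightedHomogeneous (fun i => (Pi.single (blk i) 1 : ι → ℕ)) t)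
    (hGz : ∀ g ∈ G, MvPolynomial.eval z g = 0) {F : MvPolynomial (Fin n) K}
    (hFz : MvPolynomial.eval z F ≠ 0) (T : Finset (Fin n → K))
    (hT : ∀ z' ∈ T, ∀ l, ∃ i, blk i = l ∧ z' i ≠ 0)
    (hiso : ∀ y : Fin n → K, (∀ g ∈ G, MvPolynomial.eval y g = 0) →
      MvPolynomial.eval y F ≠ 0 → ∃ z' ∈ T, ∃ τ : ι → K, y = fun i => τ (blk i) * z' i) :
    RingHom.ker (MvPolynomial.eval₂Hom (C : K →+* MvPolynomial ι K)
      (fun i => C (z i) * X (blk i))) ∈ (Ideal.span G).minimalPrimes := by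
  classical
  set 𝔓 : (Fin n → K) → Ideal (MvPolynomial (Fin n) K) := fun x => RingHom.ker
    (MvPolynomial.eval₂Hom (C : K →+* MvPolynomial ι K) (fun i => C (x i) * X (blk i)))
    with h𝔓def
  change 𝔓 z ∈ (Ideal.span G).minimalPrimes
  haveI h𝔓zprime : (𝔓 z).IsPrime := ker_multiConeSubst_isPrime blk z
  have h𝔞le : Ideal.span G ≤ 𝔓 z := by
    rw [Ideal.span_le]
    intro g hg
    obtain ⟨t, ht⟩ := hG g hg
    exact (mem_ker_multiConeSubst_iff_of_isWeightedHomogeneous blk z ht).mpr (hGz g hg)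
  obtain ⟨𝔮, h𝔮min, h𝔮le⟩ := Ideal.exists_minimalPrimes_le h𝔞le
  haveI h𝔮prime : 𝔮.IsPrime := h𝔮min.1.1
  suffices h : 𝔮 = 𝔓 z by rwa [← h]
  by_contra hne
  have hnot : ¬ 𝔓 z ≤ 𝔮 := fun h => hne (le_antisymm h𝔮le h)
  -- `dim S/𝔮 ≥ |ι| + 1`
  obtain ⟨d, hd, -⟩ := exists_nat_ringKrullDim_quotient_eq (K := K) h𝔮prime.ne_top
  have hlt := ringKrullDim_quotient_sup_lt_of_not_le hd hnot
  rw [sup_eq_right.mpr h𝔮le, ringKrullDim_quotient_ker_multiConeSubst blk hz] at hlt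
  have hd2 : Fintype.card ι + 1 ≤ d := by
    have : (Fintype.card ι : ℕ) < d := by exact_mod_cast hlt
    omega
  -- no `𝔓_{z'}` lies below `𝔮`
  have hnotz : ∀ z' ∈ T, ¬ 𝔓 z' ≤ 𝔮 := by
    intro z' hz' hle
    have hdim : ringKrullDim (MvPolynomial (Fin n) K ⧸ 𝔮) ≤
        ringKrullDim (MvPolynomial (Fin n) K ⧸ 𝔓 z') :=
      ringKrullDim_le_of_surjective (Ideal.Quotient.factor hle) (Ideal.Quotient.factor_surjective _)
    rw [hd, h𝔓def, ringKrullDim_quotient_ker_multiConeSubst blk (hT z' hz')] at hdim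
    have : d ≤ Fintype.card ι := by exact_mod_cast hdim
    omega
  have hsel : ∀ z' ∈ T, ∃ q : MvPolynomial (Fin n) K, q ∈ 𝔓 z' ∧ q ∉ 𝔮 := by
    intro z' hz'
    by_contra h
    push Not at h
    exact hnotz z' hz' fun q hq => h q hq
  choose! sel hsel𝔓 hsel𝔮 using hsel
  have hF𝔮 : F ∉ 𝔮 := fun hF => hFz (by
    simpa using eval_torusSmul_eq_zero_of_mem_ker blk (h𝔮le hF) 1)
  have hprod : F * ∏ z' ∈ T, sel z' ∉ 𝔮 := by
    intro h
    rcases h𝔮prime.mem_or_mem h with hF | hP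
    · exact hF𝔮 hF
    · obtain ⟨z', hz', hz'𝔮⟩ := Ideal.IsPrime.prod_mem_iff.mp hP
      exact hsel𝔮 z' hz' hz'𝔮
  apply hprod
  rw [← MvPolynomial.IsPrime.vanishingIdeal_zeroLocus (K := K) 𝔮, MvPolynomial.mem_vanishingIdeal_iff]
  intro y hy
  rw [MvPolynomial.mem_zeroLocus_iff] at hy
  simp only [MvPolynomial.aeval_eq_eval] at hy ⊢
  rw [map_mul, map_prod]
  by_cases hFy : MvPolynomial.eval y F = 0
  · rw [hFy, zero_mul]
  · obtain ⟨z', hz', τ, rfl⟩ := hiso y (fun g hg => hy g (h𝔮min.1.2 (Ideal.subset_span hg))) hFy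
    rw [Finset.prod_eq_zero hz' (eval_torusSmul_eq_zero_of_mem_ker blk (hsel𝔓 z' hz') τ),
      mul_zero]

/-! ## Distinct orbits impose independent conditions in large multidegree -/

/-- **Separating forms**: for finitely many points with a non-zero coordinate in every block and
pairwise distinct torus orbits, and every multidegree `t` with `|T| ≤ t_l` for all `l`, each
point `z ∈ T` has a multihomogeneous form of multidegree `t` non-vanishing at `z` and vanishing at
the other points of `T`. [folklore] -/
theorem exists_separating_form [Nonempty ι] (blk : Fin n → ι) (T : Finset (Fin n → K))
    (hT : ∀ z ∈ T, ∀ l, ∃ i, blk i = l ∧ z i ≠ 0)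
    (hTdist : ∀ z ∈ T, ∀ z' ∈ T, (∃ τ : ι → K, z' = fun i => τ (blk i) * z i) → z' = z)
    (t : ι → ℕ) (ht : ∀ l, T.card ≤ t l) (z : Fin n → K) (hz : z ∈ T) :
    ∃ g : MvPolynomial (Fin n) K,
      g.IsWeightedHomogeneous (fun i => (Pi.single (blk i) 1 : ι → ℕ)) t ∧
      MvPolynomial.eval z g ≠ 0 ∧ ∀ z' ∈ T, z' ≠ z → MvPolynomial.eval z' g = 0 := by
  classical
  set w : Fin n → ι → ℕ := fun i => Pi.single (blk i) 1 with hw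
  choose i hi hzi using hT z hz
  -- for `z' ≠ z`: an index `j` with `z'_{i_{blk j}} z_j - z'_j z_{i_{blk j}} ≠ 0`
  have hsep : ∀ z' ∈ T, z' ≠ z → ∃ j : Fin n, z' (i (blk j)) * z j - z' j * z (i (blk j)) ≠ 0 := by
    intro z' hz' hne
    by_contra hcon
    push Not at hcon
    apply hne
    apply hTdist z hz z' hz'
    refine ⟨fun l => z' (i l) * (z (i l))⁻¹, funext fun j => ?_⟩
    have h := hcon j
    have hz0 := hzi (blk j)
    field_simp
    linear_combination -h
  haveI : Nonempty (Fin n) := ⟨i (Classical.arbitrary ι)⟩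
  choose! jsep hjsep using hsep
  -- the linear forms `λ_{z'} = z'_{i_l} X_j - z'_j X_{i_l}`, `l = blk j`, `j = jsep z'`
  set lam : (Fin n → K) → MvPolynomial (Fin n) K := fun z' =>
    C (z' (i (blk (jsep z')))) * X (jsep z') - C (z' (jsep z')) * X (i (blk (jsep z')))
    with hlam
  have hlamw : ∀ z', (lam z').IsWeightedHomogeneous w (Pi.single (blk (jsep z')) 1) := by
    intro z'
    have h1 : (C (z' (i (blk (jsep z')))) * X (jsep z') : MvPolynomial (Fin n) K).IsWeightedHomogeneous
        w (Pi.single (blk (jsep z')) 1) := by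
      have := (isWeightedHomogeneous_C w (z' (i (blk (jsep z'))))).mul
        (isWeightedHomogeneous_X (R := K) w (jsep z'))
      rwa [zero_add] at this
    have h2 : (C (z' (jsep z')) * X (i (blk (jsep z'))) : MvPolynomial (Fin n) K).IsWeightedHomogeneous
        w (Pi.single (blk (jsep z')) 1) := by
      have := (isWeightedHomogeneous_C w (z' (jsep z'))).mul
        (isWeightedHomogeneous_X (R := K) w (i (blk (jsep z'))))
      rw [zero_add] at this
      convert this using 2
      rw [hi]
    exact (mem_weightedHomogeneousSubmodule K w _ _).mp ((weightedHomogeneousSubmodule K w _).sub_mem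
      ((mem_weightedHomogeneousSubmodule K w _ _).mpr h1) ((mem_weightedHomogeneousSubmodule K w _ _).mpr h2))
  have hlamz : ∀ z' ∈ T, z' ≠ z → MvPolynomial.eval z (lam z') ≠ 0 := by
    intro z' hz' hne
    simp only [hlam, map_sub, map_mul, MvPolynomial.eval_C, MvPolynomial.eval_X]
    exact hjsep z' hz' hne
  have hlamz' : ∀ z', MvPolynomial.eval z' (lam z') = 0 := by
    intro z'
    simp only [hlam, map_sub, map_mul, MvPolynomial.eval_C, MvPolynomial.eval_X]
    ring
  -- weights: `c = Σ_{z' ≠ z} e_{blk j(z')}` and the padding exponents `t - c`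
  set c : ι → ℕ := ∑ z' ∈ T.erase z, (Pi.single (blk (jsep z')) 1 : ι → ℕ) with hc
  have hcle : ∀ l, c l ≤ t l := by
    intro l
    have h1 : c l ≤ ∑ z' ∈ T.erase z, 1 := by
      rw [hc, Finset.sum_apply]
      refine Finset.sum_le_sum fun z' _ => ?_
      rw [Pi.single_apply]
      split_ifs <;> simp
    rw [Finset.sum_const, smul_eq_mul, mul_one, Finset.card_erase_of_mem hz] at h1
    have := ht l
    omega
  have hsingle : ∀ (l : ι) (k : ℕ), k • (Pi.single l 1 : ι → ℕ) = Pi.single l k := by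
    intro l k
    ext l'
    rw [Pi.smul_apply, smul_eq_mul, Pi.single_apply, Pi.single_apply]
    split_ifs <;> simp
  have hpadw : (∏ l, (X (i l) : MvPolynomial (Fin n) K) ^ (t l - c l)).IsWeightedHomogeneous w
      (∑ l, (Pi.single l (t l - c l) : ι → ℕ)) := by
    refine IsWeightedHomogeneous.prod _ _ _ fun l _ => ?_
    have := (isWeightedHomogeneous_X (R := K) w (i l)).pow (t l - c l)
    rw [show w (i l) = Pi.single l 1 by rw [hw]; simp [hi]] at this
    rwa [hsingle] at this
  have hsumw : c + ∑ l, (Pi.single l (t l - c l) : ι → ℕ) = t := by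
    funext l
    rw [Pi.add_apply, Finset.sum_apply, Finset.sum_eq_single l (fun l' _ hl' => by
      rw [Pi.single_apply, if_neg (Ne.symm hl')]) (fun h => absurd (mem_univ l) h),
      Pi.single_eq_same]
    have := hcle l
    omega
  refine ⟨(∏ z' ∈ T.erase z, lam z') * ∏ l, (X (i l) : MvPolynomial (Fin n) K) ^ (t l - c l),
    ?_, ?_, ?_⟩
  · have hg := (IsWeightedHomogeneous.prod (T.erase z) lam (fun z' => (Pi.single (blk (jsep z')) 1 : ι → ℕ))
      fun z' _ => hlamw z').mul hpadw
    rw [← hc, hsumw] at hg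
    exact hg
  · rw [map_mul, map_prod, map_prod]
    refine mul_ne_zero (Finset.prod_ne_zero_iff.mpr fun z' hz' => ?_)
      (Finset.prod_ne_zero_iff.mpr fun l _ => ?_)
    · exact hlamz z' (Finset.mem_of_mem_erase hz') (Finset.ne_of_mem_erase hz')
    · rw [map_pow, MvPolynomial.eval_X]
      exact pow_ne_zero _ (hzi l)
  · intro z' hz' hne
    rw [map_mul, map_prod, Finset.prod_eq_zero (Finset.mem_erase.mpr ⟨hne, hz'⟩) (hlamz' z'),
      zero_mul]

/-- **Distinct orbits impose independent conditions on forms of large multidegree**: for a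
finite set `T` of points with a non-zero coordinate in every block and pairwise distinct torus
orbits, `H(⋂_{z ∈ T} 𝔓_z; t) = |T|` whenever `t_l ≥ |T|` for all `l` (the evaluation map
`S_t → K^T` has kernel `(⋂ 𝔓_z)_t` and is onto by `exists_separating_form`). [folklore] -/
theorem hilbert_inf_multiCone_eq_card [Nonempty ι] (blk : Fin n → ι) (T : Finset (Fin n → K))
    (hT : ∀ z ∈ T, ∀ l, ∃ i, blk i = l ∧ z i ≠ 0)
    (hTdist : ∀ z ∈ T, ∀ z' ∈ T, (∃ τ : ι → K, z' = fun i => τ (blk i) * z i) → z' = z)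
    (t : ι → ℕ) (ht : ∀ l, T.card ≤ t l) :
    finrank K (weightedHomogeneousSubmodule K (fun i => (Pi.single (blk i) 1 : ι → ℕ)) t) -
      finrank K ↥(Submodule.restrictScalars K (T.inf fun z => RingHom.ker
        (MvPolynomial.eval₂Hom (C : K →+* MvPolynomial ι K) (fun i => C (z i) * X (blk i)))) ⊓
          weightedHomogeneousSubmodule K (fun i => (Pi.single (blk i) 1 : ι → ℕ)) t) = T.card := by
  classical
  set w : Fin n → ι → ℕ := fun i => Pi.single (blk i) 1 with hw
  have hwne : ∀ i, w i ≠ 0 := fun i h => by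
    have := congr_fun h (blk i)
    simp [hw] at this
  haveI : Module.Finite K (weightedHomogeneousSubmodule K w t) :=
    finite_weightedHomogeneousSubmodule_of_ne_zero w hwne t
  set V := weightedHomogeneousSubmodule K w t with hV
  set 𝔓 : (Fin n → K) → Ideal (MvPolynomial (Fin n) K) := fun z => RingHom.ker
    (MvPolynomial.eval₂Hom (C : K →+* MvPolynomial ι K) (fun i => C (z i) * X (blk i))) with h𝔓
  -- the evaluation map
  set ev : V →ₗ[K] (↥T → K) :=
    { toFun := fun v z => MvPolynomial.eval (z : Fin n → K) (v : MvPolynomial (Fin n) K)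
      map_add' := fun v v' => by funext z; simp
      map_smul' := fun a v => by funext z; simp [MvPolynomial.smul_eval] } with hev
  -- its kernel is the piece of `⋂ 𝔓_z`
  have hker : (Submodule.restrictScalars K (T.inf 𝔓) ⊓ V) = (LinearMap.ker ev).map V.subtype := by
    ext g
    rw [mem_wpiece, Submodule.mem_map]
    constructor
    · rintro ⟨hgI, hgt⟩
      refine ⟨⟨g, (mem_weightedHomogeneousSubmodule K w t g).mpr hgt⟩, ?_, rfl⟩
      rw [LinearMap.mem_ker]
      funext z
      have hz : g ∈ 𝔓 z := (Submodule.mem_finsetInf.mp hgI) z z.2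
      exact (mem_ker_multiConeSubst_iff_of_isWeightedHomogeneous blk (z : Fin n → K) hgt).mp hz
    · rintro ⟨v, hv, rfl⟩
      have hvt : (v : MvPolynomial (Fin n) K).IsWeightedHomogeneous w t :=
        (mem_weightedHomogeneousSubmodule K w t _).mp v.2
      refine ⟨Submodule.mem_finsetInf.mpr fun z hz => ?_, hvt⟩
      rw [LinearMap.mem_ker] at hv
      have := congr_fun hv ⟨z, hz⟩
      exact (mem_ker_multiConeSubst_iff_of_isWeightedHomogeneous blk z hvt).mpr this
  -- it is onto
  have hsurj : Function.Surjective ev := by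
    intro b
    have hsep := fun z (hz : z ∈ T) => exists_separating_form blk T hT hTdist t ht z hz
    choose! g hgw hgz hgz' using hsep
    refine ⟨∑ z ∈ T.attach, (b z * (MvPolynomial.eval (z : Fin n → K) (g z))⁻¹) •
      ⟨g z, (mem_weightedHomogeneousSubmodule K w t _).mpr (hgw z z.2)⟩, ?_⟩
    funext z₀
    rw [map_sum]
    simp only [map_smul, Finset.sum_apply, Pi.smul_apply, smul_eq_mul]
    rw [Finset.sum_eq_single z₀]
    · change b z₀ * (MvPolynomial.eval (z₀ : Fin n → K) (g z₀))⁻¹ *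
        MvPolynomial.eval (z₀ : Fin n → K) (g z₀) = b z₀
      rw [mul_assoc, inv_mul_cancel₀ (hgz z₀ z₀.2), mul_one]
    · intro z _ hne
      change b z * (MvPolynomial.eval (z : Fin n → K) (g z))⁻¹ *
        MvPolynomial.eval (z₀ : Fin n → K) (g z) = 0
      rw [hgz' z z.2 z₀ z₀.2 (fun h => hne (Subtype.ext h).symm), mul_zero]
    · intro h; exact absurd (Finset.mem_attach _ _) h
  -- rank-nullity
  have hrn := LinearMap.finrank_range_add_finrank_ker ev
  rw [LinearMap.range_eq_top.mpr hsurj, finrank_top, Module.finrank_fintype_fun_eq_card,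
    Fintype.card_coe] at hrn
  have hkerdim : finrank K ↥(Submodule.restrictScalars K (T.inf 𝔓) ⊓ V) = finrank K (LinearMap.ker ev) := by
    rw [hker]
    exact LinearEquiv.finrank_eq (Submodule.equivMapOfInjective _ V.injective_subtype _).symm
  change finrank K V - finrank K ↥(Submodule.restrictScalars K (T.inf 𝔓) ⊓ V) = T.card
  rw [hkerdim]
  omega

/-! ## The count of isolated points -/

/-- **Refined Bézout theorem in a product of projective spaces, count of isolated points**
(Fulton, *Intersection Theory*, Ex. 12.3.1 / Thm. 12.3): over an algebraically closed field, let
`Q_1, …, Q_r` (`r + |ι| = n`, all blocks non-empty) be non-zero forms multihomogeneous for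
`blk : Fin n → ι` of multidegrees `δ_j`, and `T` a finite set of common zeros with a non-zero
coordinate in every block and pairwise distinct torus orbits, each isolated: for every `z ∈ T`
some polynomial `F` with `F(z) ≠ 0` has all common zeros `y` of the `Q_j` with `F(y) ≠ 0` in the
torus orbits of points of `T`. Then `|T| ≤ [T^{(n_l - 1)_l}] Π_j (Σ_l δ_{j,l} T_l)`, whatever
the positive-dimensional part of `V(Q_1, …, Q_r)`. [cite: Fulton1998, Example 12.3.1] -/
theorem card_le_mixedBezout_of_isolated [IsAlgClosed K] [Nonempty ι] {r : ℕ} (blk : Fin n → ι)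
    (hblk : ∀ l, 1 ≤ ((univ : Finset (Fin n)).filter (fun i => blk i = l)).card)
    (hr : r + Fintype.card ι = n)
    (Q : Fin r → MvPolynomial (Fin n) K) (δ : Fin r → ι → ℕ)
    (hQ : ∀ j, (Q j).IsWeightedHomogeneous (fun i => (Pi.single (blk i) 1 : ι → ℕ)) (δ j))
    (hQ0 : ∀ j, Q j ≠ 0) (T : Finset (Fin n → K))
    (hT : ∀ z ∈ T, ∀ l, ∃ i, blk i = l ∧ z i ≠ 0)
    (hTdist : ∀ z ∈ T, ∀ z' ∈ T, (∃ τ : ι → K, z' = fun i => τ (blk i) * z i) → z' = z)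
    (hTQ : ∀ z ∈ T, ∀ j, MvPolynomial.eval z (Q j) = 0)
    (hiso : ∀ z ∈ T, ∃ F : MvPolynomial (Fin n) K, MvPolynomial.eval z F ≠ 0 ∧
      ∀ y : Fin n → K, (∀ j, MvPolynomial.eval y (Q j) = 0) → MvPolynomial.eval y F ≠ 0 →
        ∃ z' ∈ T, ∃ τ : ι → K, y = fun i => τ (blk i) * z' i) :
    T.card ≤ coeff (Finsupp.equivFunOnFinite.symm fun l =>
        ((univ : Finset (Fin n)).filter (fun i => blk i = l)).card - 1)
      (∏ j, ∑ l, δ j l • (X l : MvPolynomial ι ℕ)) := by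
  classical
  set 𝔓 : (Fin n → K) → Ideal (MvPolynomial (Fin n) K) := fun z => RingHom.ker
    (MvPolynomial.eval₂Hom (C : K →+* MvPolynomial ι K) (fun i => C (z i) * X (blk i))) with h𝔓
  -- `z ↦ 𝔓_z` is injective on `T`
  have hinj : Set.InjOn 𝔓 T := by
    intro z hz z' hz' h
    obtain ⟨τ, hτ⟩ := exists_eq_torusSmul_of_ker_eq blk (hT z hz) h
    exact (hTdist z hz z' hz' ⟨τ, hτ⟩).symm
  rw [← Finset.card_image_of_injOn hinj]
  have hG : ∀ g ∈ Set.range Q, ∃ t, g.IsWeightedHomogeneous (fun i => (Pi.single (blk i) 1 : ι → ℕ)) t := by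
    rintro _ ⟨j, rfl⟩; exact ⟨δ j, hQ j⟩
  refine card_le_mixedBezout blk hblk hr Q δ hQ hQ0 (T.image 𝔓) (fun 𝔓' h𝔓' => ?_) ?_
  · obtain ⟨z, hz, rfl⟩ := Finset.mem_image.mp h𝔓'
    obtain ⟨F, hFz, hF⟩ := hiso z hz
    refine ⟨ker_multiConeSubst_mem_minimalPrimes_of_isolated blk (hT z hz) hG ?_ hFz T hT ?_,
      ringKrullDim_quotient_ker_multiConeSubst blk (hT z hz)⟩
    · rintro _ ⟨j, rfl⟩; exact hTQ z hz j
    · intro y hyG hyF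
      exact hF y (fun j => hyG (Q j) ⟨j, rfl⟩) hyF
  · refine ⟨fun _ => T.card, fun t ht => ?_⟩
    rw [Finset.inf_image, Finset.card_image_of_injOn hinj]
    exact hilbert_inf_multiCone_eq_card blk T hT hTdist t fun l => ht l


/-! ## Transport to arbitrary finite index types -/

/-- Weighted homogeneity is transported along a renaming of the variables by an equivalence.
[folklore] -/
theorem isWeightedHomogeneous_rename_equiv {R : Type*} [CommSemiring R] {σ τ M : Type*}
    [AddCommMonoid M] (e : σ ≃ τ) (w : τ → M) {φ : MvPolynomial σ R} {m : M}
    (h : φ.IsWeightedHomogeneous (fun i => w (e i)) m) :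
    (rename e φ).IsWeightedHomogeneous w m := by
  classical
  intro d hd
  set d' : σ →₀ ℕ := d.mapDomain e.symm with hd'
  have hdd : d = d'.mapDomain e := by
    rw [hd', ← Finsupp.mapDomain_comp]
    simp
  have hc : coeff d' φ ≠ 0 := by
    rw [hdd, coeff_rename_mapDomain e e.injective] at hd
    exact hd
  have hw := h hc
  rw [hdd]
  rw [Finsupp.weight_apply, Finsupp.sum_mapDomain_index_inj e.injective]
  rw [Finsupp.weight_apply] at hw
  exact hw

/-- **Refined Bézout count of isolated points, arbitrary finite index types**: the statement of
`card_le_mixedBezout_of_isolated` for variables indexed by a finite type `τ` and cuts indexed by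
a finite type `J` with `|J| + |ι| = |τ|` (transport along `Fintype.equivFin`).
[cite: Fulton1998, Example 12.3.1] -/
theorem card_le_mixedBezout_of_isolated_fintype [IsAlgClosed K] [Nonempty ι] {τ J : Type*}
    [Fintype τ] [DecidableEq τ] [Fintype J] (blk : τ → ι) (hblk : ∀ l, ∃ i, blk i = l)
    (hr : Fintype.card J + Fintype.card ι = Fintype.card τ)
    (Q : J → MvPolynomial τ K) (δ : J → ι → ℕ)
    (hQ : ∀ j, (Q j).IsWeightedHomogeneous (fun i => (Pi.single (blk i) 1 : ι → ℕ)) (δ j))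
    (hQ0 : ∀ j, Q j ≠ 0) (T : Finset (τ → K))
    (hT : ∀ z ∈ T, ∀ l, ∃ i, blk i = l ∧ z i ≠ 0)
    (hTdist : ∀ z ∈ T, ∀ z' ∈ T, (∃ c : ι → K, z' = fun i => c (blk i) * z i) → z' = z)
    (hTQ : ∀ z ∈ T, ∀ j, MvPolynomial.eval z (Q j) = 0)
    (hiso : ∀ z ∈ T, ∃ F : MvPolynomial τ K, MvPolynomial.eval z F ≠ 0 ∧
      ∀ y : τ → K, (∀ j, MvPolynomial.eval y (Q j) = 0) → MvPolynomial.eval y F ≠ 0 →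
        ∃ z' ∈ T, ∃ c : ι → K, y = fun i => c (blk i) * z' i) :
    T.card ≤ coeff (Finsupp.equivFunOnFinite.symm fun l =>
        ((univ : Finset τ).filter (fun i => blk i = l)).card - 1)
      (∏ j, ∑ l, δ j l • (X l : MvPolynomial ι ℕ)) := by
  classical
  set e := Fintype.equivFin τ with he
  set eJ := Fintype.equivFin J with heJ
  set blk' : Fin (Fintype.card τ) → ι := fun i => blk (e.symm i) with hblk'
  set Q' : Fin (Fintype.card J) → MvPolynomial (Fin (Fintype.card τ)) K :=
    fun j => rename e (Q (eJ.symm j)) with hQ'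
  set δ' : Fin (Fintype.card J) → ι → ℕ := fun j => δ (eJ.symm j) with hδ'
  have hcomp : ∀ z : τ → K, (fun i => z (e.symm (e i))) = z := fun z => by
    funext i; rw [Equiv.symm_apply_apply]
  have hinj : Function.Injective (fun z : τ → K => fun i : Fin (Fintype.card τ) => z (e.symm i)) := by
    intro z z' h
    rw [← hcomp z, ← hcomp z']
    funext i
    exact congrFun h (e i)
  set T' : Finset (Fin (Fintype.card τ) → K) := T.map ⟨_, hinj⟩ with hT'
  have hmemT' : ∀ z', z' ∈ T' ↔ ∃ z ∈ T, z' = fun i => z (e.symm i) := by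
    intro z'
    simp only [hT', Finset.mem_map, Function.Embedding.coeFn_mk]
    exact ⟨fun ⟨z, hz, h⟩ => ⟨z, hz, h.symm⟩, fun ⟨z, hz, h⟩ => ⟨z, hz, h.symm⟩⟩
  have hevalQ : ∀ (z : τ → K) j, MvPolynomial.eval (fun i => z (e.symm i)) (Q' j) =
      MvPolynomial.eval z (Q (eJ.symm j)) := by
    intro z j
    rw [hQ', eval_rename]
    exact congrArg (fun y => MvPolynomial.eval y (Q (eJ.symm j))) (hcomp z)
  have hevalF : ∀ (z : τ → K) (F : MvPolynomial τ K),
      MvPolynomial.eval (fun i => z (e.symm i)) (rename e F) = MvPolynomial.eval z F := by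
    intro z F
    rw [eval_rename]
    exact congrArg (fun y => MvPolynomial.eval y F) (hcomp z)
  have hblk'' : ∀ l, 1 ≤ ((univ : Finset (Fin (Fintype.card τ))).filter (fun i => blk' i = l)).card := by
    intro l
    obtain ⟨i, hi⟩ := hblk l
    exact Finset.card_pos.mpr ⟨e i, by simp [hblk', hi]⟩
  have hQ'' : ∀ j, (Q' j).IsWeightedHomogeneous (fun i => (Pi.single (blk' i) 1 : ι → ℕ)) (δ' j) := by
    intro j
    refine isWeightedHomogeneous_rename_equiv e _ ?_
    have hw : (fun i => (Pi.single (blk' (e i)) 1 : ι → ℕ)) = fun i => Pi.single (blk i) 1 := by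
      funext i; simp [hblk']
    rw [hw]
    exact hQ (eJ.symm j)
  have hQ0' : ∀ j, Q' j ≠ 0 := fun j h => hQ0 (eJ.symm j) (rename_injective _ e.injective
    (by rw [map_zero]; exact h))
  have hT'' : ∀ z' ∈ T', ∀ l, ∃ i, blk' i = l ∧ z' i ≠ 0 := by
    intro z' hz' l
    obtain ⟨z, hz, rfl⟩ := (hmemT' z').mp hz'
    obtain ⟨i, hi, hzi⟩ := hT z hz l
    exact ⟨e i, by simp [hblk', hi], by simpa using hzi⟩
  have hTdist' : ∀ z' ∈ T', ∀ z'' ∈ T', (∃ c : ι → K, z'' = fun i => c (blk' i) * z' i) →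
      z'' = z' := by
    intro z' hz' z'' hz'' ⟨c, hc⟩
    obtain ⟨z, hz, rfl⟩ := (hmemT' z').mp hz'
    obtain ⟨z₂, hz₂, rfl⟩ := (hmemT' z'').mp hz''
    have h2 : z₂ = fun i => c (blk i) * z i := by
      funext i
      have := congrFun hc (e i)
      simpa [hblk'] using this
    rw [hTdist z hz z₂ hz₂ ⟨c, h2⟩]
  have hTQ' : ∀ z' ∈ T', ∀ j, MvPolynomial.eval z' (Q' j) = 0 := by
    intro z' hz' j
    obtain ⟨z, hz, rfl⟩ := (hmemT' z').mp hz'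
    rw [hevalQ]; exact hTQ z hz _
  have hiso' : ∀ z' ∈ T', ∃ F : MvPolynomial (Fin (Fintype.card τ)) K,
      MvPolynomial.eval z' F ≠ 0 ∧ ∀ y : Fin (Fintype.card τ) → K,
        (∀ j, MvPolynomial.eval y (Q' j) = 0) → MvPolynomial.eval y F ≠ 0 →
          ∃ z'' ∈ T', ∃ c : ι → K, y = fun i => c (blk' i) * z'' i := by
    intro z' hz'
    obtain ⟨z, hz, rfl⟩ := (hmemT' z').mp hz'
    obtain ⟨F, hFz, hF⟩ := hiso z hz
    refine ⟨rename e F, by rw [hevalF]; exact hFz, fun y hyQ hyF => ?_⟩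
    have hyfun : (fun i => (fun k => y (e k)) (e.symm i)) = y := by
      funext i; simp
    obtain ⟨z₁, hz₁, c, hc⟩ := hF (fun k => y (e k)) (fun j => by
        have h2 := hevalQ (fun k => y (e k)) (eJ j)
        rw [hyfun, hyQ, Equiv.symm_apply_apply] at h2
        exact h2.symm) (by
        have h2 := hevalF (fun k => y (e k)) F
        rw [hyfun] at h2
        rw [← h2]
        exact hyF)
    refine ⟨fun i => z₁ (e.symm i), (hmemT' _).mpr ⟨z₁, hz₁, rfl⟩, c, ?_⟩
    rw [← hyfun]
    funext i
    have := congrFun hc (e.symm i)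
    simpa [hblk'] using this
  have key := card_le_mixedBezout_of_isolated blk' hblk'' hr Q' δ' hQ'' hQ0' T' hT'' hTdist' hTQ'
    hiso'
  rw [hT', Finset.card_map] at key
  have hcardl : ∀ l, ((univ : Finset (Fin (Fintype.card τ))).filter (fun i => blk' i = l)).card =
      ((univ : Finset τ).filter (fun i => blk i = l)).card := by
    intro l
    have hset : (univ : Finset (Fin (Fintype.card τ))).filter (fun i => blk' i = l) =
        ((univ : Finset τ).filter (fun i => blk i = l)).map e.toEmbedding := by
      ext i
      simp [Finset.mem_map_equiv, hblk']
    rw [hset, Finset.card_map]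
  convert key using 2
  · ext l
    simp [hcardl]
  · exact Fintype.prod_equiv eJ _ _ fun j => by simp [hδ']

end MultiCone

end Literature.RingTheory.MvPolynomial

end
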